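import Summits.HodgeConjecture.HodgeConjecture.Theorems.MotivatedLefschetzSplitLefschetzStandardBLefschetzProjections
import Literature.AlgebraicGeometry.HodgeTheory.HodgeSectionRestrictionPairing
import HarnessLib

/-!
# Crux `LefschetzStandardB` (stmt-HodgeConjecture-17489), line `birth` — towards stub 3 `stub_charlesSpread`, II:
# the POLARISATION OPERATOR `Φ = L^{l-b} ∘ s` of `Hᵇ(S(ℂ); ℂ)`: `Q(x, y) = τ(Φ x ∪ y)`, and `Φ` is an algebraic
# correspondence granted `B(S)` below `b`

Route `HodgeConjecture/MotivatedLefschetzSplit`, crux #3 `LefschetzStandardB`; registered skeleton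
`Cruxes/LefschetzStandardB/Lines/birth.lean`. In Charles's spread (2013, Prop. 8 ⇐) the bijective self-correspondence
is `θ = [Γ]_* ∘ L^{l-b} ∘ s ∘ [Γ]^t` with `s` the sign operator of the Lefschetz decomposition of `Hᵇ(S)`; what is
used of `L^{l-b} ∘ s` is that it turns the POLARISATION FORM of the Lefschetz decomposition (Voisin I §6.3.2 /
§7.1.2: `Q(x, y) = ∑_{a+2t=b} (-1)^{a(a-1)/2} τ(L^{l-a} ξ_{(a,t)} x ∪ ξ_{(a,t)} y)`, the tree's `polarizationForm`)
into a plain cup-product pairing. This file isolates that operator on the tree's real carriers, for `S` smooth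
projective of dimension `l`, `κ ∈ H²(S(ℂ); ℂ)` with the hard Lefschetz property and `b ≤ l`, `a' + b = 2l`:

  `Φ := ∑_{p=(a,t)} (-1)^{a(a-1)/2} L^{l-a-t} ∘ ξ_p : Hᵇ(S(ℂ); ℂ) → Hᵃ'(S(ℂ); ℂ)` (written out as a sum, no definition),

* §1 `trace_cup_lefschetzPowTo_primitivePart` — ORTHOGONALITY of the Lefschetz components for the pairing
  `(u, v) ↦ τ(L^• u ∪ v)`: `τ(L^{l-a-t} ξ_p x ∪ y) = τ(L^{l-a} ξ_p x ∪ ξ_p y)` (the components `Lᵗ' ξ_{p'} y`, `p' ≠ p`,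
  pair to `0` with `L^{l-a-t} ξ_p x`, a power `≥ l - deg + 1` of `L` killing one of the two primitive classes);
* §2 **`polarizationForm_eq_trace_cup_sum`**: `Q(x, y) = τ(Φ x ∪ y)` for all `x, y ∈ Hᵇ`;
* §3 **`isAlgebraicCorrespondence_polarizationOperator`**: for a polarisation class `κ`, granted `B(S)` in the target
  degrees `≤ b − 2`, `Φ` is an algebraic correspondence (part I: the `ξ_p` are; Lefschetz iterates of a divisor class
  are; algebraic correspondences form a `ℂ`-linear category).

Nothing here is a case of the Hodge conjecture or of `B(X)`; no definition, no named fact, no sorry.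
References: [Charles2013] Prop. 8 and Lemma 7 (arXiv:1002.5011); [VoisinHodgeI2002] §6.2.3 Cor. 6.26, §6.3.2 (6.13),
Thm. 6.32, Rem. 6.33, §7.1.2; [HatcherAT2002] §3.2 p. 211, Thm. 3.11; [Andre1996Motifs] §1.1.
-/

noncomputable section

-- every declaration of this problem lives in `Summit.HodgeConjecture.HodgeConjecture.…` (summit = sub-problem)
set_option linter.dupNamespace false

open CategoryTheory AlgebraicGeometry
open Literature.AlgebraicGeometry.Motives Literature.AlgebraicGeometry.HodgeTheory
open Literature.Geometry.Kaehler (lefschetzOperator lefschetzPow HasHardLefschetzProperty lefschetzOperator_apply)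
open Literature.AlgebraicTopology.SingularHomology (singularCohomology cupProduct)
open Summit.HodgeConjecture.HodgeConjecture.Ring2.AbelianAll

namespace Summit.HodgeConjecture.HodgeConjecture.Theorems.LefschetzStandardB

variable {l : ℕ} {S : SchemeOver ℂ}

/-! ## §1 Orthogonality of the Lefschetz components -/

section Orthogonality

variable {κ : complexBetti S 2} (hL : HasHardLefschetzProperty κ l)
  (hvan : ∀ m, 2 * l < m → Subsingleton (complexBetti S m))

/-- **Two different Lefschetz components pair to zero.** For `ξ ∈ Pᵃ`, `ξ' ∈ Pᵃ'` primitive, indices `(a, t) ≠ (a', t')`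
of the same degree `b = a + 2t = a' + 2t'`, `a + t + u = l`, and any trace `τ` on `H^{2l}`:
`τ(L^u ξ ∪ L^{t'} ξ') = 0` — all the `L`'s moved onto one side give `L^{u+t'}` on `ξ` (zero if `t' > t`: exponent
`≥ l - a + 1`) or on `ξ'` (zero if `t' < t`: exponent `≥ l - a' + 1`). [cite: VoisinHodgeI2002, §6.2.3 and §6.3.2 (6.13)]
[cite: HatcherAT2002, §3.2 p. 211] -/
theorem cup_lefschetzPowTo_lefschetzPowTo_eq_zero_of_ne {a t a₁ t₁ b u a' : ℕ} (hp : a + 2 * t = b) (hp₁ : a₁ + 2 * t₁ = b)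
    (hne : t ≠ t₁) (hu : a + t + u = l) (hua : a + 2 * u = a') (hab : a' + b = 2 * l)
    {ξ : complexBetti S a} (hξ : ξ ∈ primitiveClasses κ l a) {ξ₁ : complexBetti S a₁}
    (hξ₁ : ξ₁ ∈ primitiveClasses κ l a₁) :
    cupProduct hab (lefschetzPowTo κ u a a' hua ξ) (lefschetzPowTo κ t₁ a₁ b hp₁ ξ₁) = 0 := by
  rcases Nat.lt_or_gt_of_ne hne with h | h
  · -- `t < t₁`: move `L^{t₁}` to the left factor, `L^{u + t₁} ξ = 0`
    rw [cupProduct_lefschetzPowTo_right κ t₁ hp₁ hab (by omega : a' + a₁ = a' + a₁)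
        (by omega : a' + a₁ + 2 * t₁ = 2 * l),
      ← cupProduct_lefschetzPowTo_left κ t₁ (by omega : a' + 2 * t₁ = a' + 2 * t₁) (by omega) (by omega)
        (by omega : a' + a₁ + 2 * t₁ = 2 * l),
      lefschetzPowTo_lefschetzPowTo κ t₁ hua rfl (by omega : a + 2 * (u + t₁) = a' + 2 * t₁),
      lefschetzPowTo_eq_zero_of_mem_primitiveClasses hξ _ (by omega), LinearMap.map_zero₂]
  · -- `t₁ < t`: move `L^u` to the right factor, `L^{u + t₁} ξ₁ = 0`
    rw [cupProduct_lefschetzPowTo_left κ u hua hab (by omega : a + b = a + b) (by omega : a + b + 2 * u = 2 * l),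
      ← cupProduct_lefschetzPowTo_right κ u (by omega : b + 2 * u = b + 2 * u) (by omega) (by omega)
        (by omega : a + b + 2 * u = 2 * l),
      lefschetzPowTo_lefschetzPowTo κ u hp₁ rfl (by omega : a₁ + 2 * (t₁ + u) = b + 2 * u),
      lefschetzPowTo_eq_zero_of_mem_primitiveClasses hξ₁ _ (by omega), LinearMap.map_zero]

/-- **The Lefschetz component of index `p` of `y` is the only one that pairs with `L^u ξ_p x`**: for `p = (a, t)`,
`a + 2t = b`, `a + t + u = l`, `a + 2u = a'`, `a' + b = 2l`, and `s = t + u` (so `a + s = l`, `a + 2s + a = 2l`):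
`L^u (ξ_p x) ∪ y = L^s (ξ_p x ∪ ξ_p y)`-wise, `τ`-free: `L^u ξ_p x ∪ y = Lᵗ(L^u ξ_p x ∪ ξ_p y)` summed over the
decomposition of `y`, i.e. `cupProduct (L^u ξ_p x) y = cupProduct (L^s ξ_p x) (ξ_p y)` in `H^{2l}`.
[cite: VoisinHodgeI2002, §6.2.3 Cor. 6.26 and §6.3.2 (6.13)] [cite: HatcherAT2002, §3.2 p. 211] -/
theorem cup_lefschetzPowTo_primitivePart_eq {b a' : ℕ} (hab : a' + b = 2 * l)
    (p : {p : ℕ × ℕ // p.1 + 2 * p.2 = b}) {u s m : ℕ} (hu : p.1.1 + p.1.2 + u = l) (hua : p.1.1 + 2 * u = a')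
    (hs : p.1.2 + u = s) (hm : p.1.1 + 2 * s = m) (hma : m + p.1.1 = 2 * l) (x y : complexBetti S b) :
    cupProduct hab (lefschetzPowTo κ u p.1.1 a' hua (primitivePart κ l hL hvan p x)) y =
      cupProduct hma (lefschetzPowTo κ s p.1.1 m hm (primitivePart κ l hL hvan p x))
        (primitivePart κ l hL hvan p y) := by
  conv_lhs => rw [← sum_lefschetzPowTo_primitivePart hL hvan y]
  rw [map_sum, Finset.sum_eq_single p]
  · -- the diagonal term: `L^u ξ ∪ Lᵗ ξ' = L^{u+t} (ξ ∪ ξ') = L^s ξ ∪ ξ'`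
    rw [cupProduct_lefschetzPowTo_right κ p.1.2 p.2 hab (by omega : a' + p.1.1 = a' + p.1.1)
        (by omega : a' + p.1.1 + 2 * p.1.2 = 2 * l),
      cupProduct_lefschetzPowTo_left κ u hua (rfl : a' + p.1.1 = a' + p.1.1)
        (by omega : p.1.1 + p.1.1 = p.1.1 + p.1.1) (by omega : p.1.1 + p.1.1 + 2 * u = a' + p.1.1),
      lefschetzPowTo_lefschetzPowTo κ p.1.2 (by omega : p.1.1 + p.1.1 + 2 * u = a' + p.1.1) (by omega)
        (by omega : p.1.1 + p.1.1 + 2 * (u + p.1.2) = 2 * l),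
      cupProduct_lefschetzPowTo_left κ s hm hma (by omega : p.1.1 + p.1.1 = p.1.1 + p.1.1)
        (by omega : p.1.1 + p.1.1 + 2 * s = 2 * l)]
    exact lefschetzPowTo_congr_exponent κ (by omega) _ _ _
  · intro q _ hqp
    have hne : p.1.2 ≠ q.1.2 := by
      intro h
      apply hqp
      have hp2 := p.2
      have hq2 := q.2
      exact Subtype.ext (Prod.ext (by omega) h.symm)
    exact cup_lefschetzPowTo_lefschetzPowTo_eq_zero_of_ne (κ := κ) p.2 q.2 hne hu hua hab
      (primitivePart_mem hL hvan p x) (primitivePart_mem hL hvan q y)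
  · intro h
    exact absurd (Finset.mem_univ p) h

/-- **The Hodge–Riemann pairing of the `p`-th primitive parts as a plain cup product**: for `p = (a, t)`,
`a + 2t = b ≤ l`, `a + t + u = l`, `a + 2u = a'`, `a' + b = 2l`:
`B_a(ξ_p x, ξ_p y) = (-1)^{a(a-1)/2} τ(L^u ξ_p x ∪ y)`. [cite: VoisinHodgeI2002, §6.3.2 (6.13) and Thm. 6.32] -/
theorem hodgeRiemannPairing_primitivePart_eq (τ : complexBetti S (2 * l) →ₗ[ℂ] ℂ) {b a' : ℕ} (hab : a' + b = 2 * l)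
    (p : {p : ℕ × ℕ // p.1 + 2 * p.2 = b}) {u : ℕ} (hu : p.1.1 + p.1.2 + u = l) (hua : p.1.1 + 2 * u = a')
    (x y : complexBetti S b) :
    hodgeRiemannPairing κ l τ p.1.1 (primitivePart κ l hL hvan p x) (primitivePart κ l hL hvan p y) =
      (-1 : ℂ) ^ (p.1.1 * (p.1.1 - 1) / 2) *
        τ (cupProduct hab (lefschetzPowTo κ u p.1.1 a' hua (primitivePart κ l hL hvan p x)) y) := by
  rw [hodgeRiemannPairing_apply τ (by omega : p.1.1 + (p.1.2 + u) = l) rfl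
      (by omega : p.1.1 + 2 * (p.1.2 + u) + p.1.1 = 2 * l),
    cup_lefschetzPowTo_primitivePart_eq hL hvan hab p hu hua rfl rfl _ x y]

end Orthogonality

/-! ## §2 The polarisation form as a cup product against the polarisation operator -/

/-- **`Q(x, y) = τ(Φ x ∪ y)`.** For `κ ∈ H²(S(ℂ); ℂ)` with the hard Lefschetz property in dimension `l`, `Hᵐ = 0` above
`2l`, a trace `τ`, and degrees `b ≤ l`, `a' + b = 2l`: the polarisation form of the Lefschetz decomposition of `Hᵇ`
(Voisin I §6.3.2/§7.1.2, the tree's `polarizationForm`) is the cup-product pairing against the POLARISATION OPERATOR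
`Φ x = ∑_{p=(a,t)} (-1)^{a(a-1)/2} L^{l-a-t} (ξ_p x) ∈ Hᵃ'` (orthogonality of the Lefschetz components, §1).
[cite: VoisinHodgeI2002, §6.3.2 (6.13), Thm. 6.32, Rem. 6.33 and §7.1.2] [cite: Charles2013, proof of Prop. 8 (arXiv:1002.5011)] -/
theorem polarizationForm_eq_trace_cup_sum {κ : complexBetti S 2} (hL : HasHardLefschetzProperty κ l)
    (hvan : ∀ m, 2 * l < m → Subsingleton (complexBetti S m)) (τ : complexBetti S (2 * l) →ₗ[ℂ] ℂ)
    {b a' : ℕ} (hbl : b ≤ l) (hab : a' + b = 2 * l) (x y : complexBetti S b) :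
    polarizationForm κ l hL hvan τ b x y =
      τ (cupProduct hab
        ((∑ p : {p : ℕ × ℕ // p.1 + 2 * p.2 = b},
          ((-1 : ℂ) ^ (p.1.1 * (p.1.1 - 1) / 2)) •
            (lefschetzPowTo κ (l - p.1.1 - p.1.2) p.1.1 a' (by have := p.2; omega) ∘ₗ
              primitivePart κ l hL hvan p)) x) y) := by
  rw [polarizationForm_apply, LinearMap.sum_apply, map_sum, LinearMap.sum_apply, map_sum]
  refine Finset.sum_congr rfl fun p _ ↦ ?_
  rw [LinearMap.smul_apply, LinearMap.comp_apply, map_smul, LinearMap.smul_apply, map_smul, smul_eq_mul]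
  exact hodgeRiemannPairing_primitivePart_eq hL hvan τ hab p (by have := p.2; omega) _ x y

/-! ## §3 The polarisation operator is an algebraic correspondence -/

/-- **`Φ = ∑_p (-1)^{a(a-1)/2} L^{l-a-t} ∘ ξ_p : Hᵇ(S(ℂ); ℂ) → Hᵃ'(S(ℂ); ℂ)` is an algebraic correspondence**, for `S`
smooth projective of dimension `l`, a polarisation class `κ`, `b ≤ l`, `a' + b = 2l`, GRANTED conjecture `B(S)` (for `κ`)
in the target degrees `≤ b − 2`: the primitive parts `ξ_p` are algebraic correspondences (part I,
`isAlgebraicCorrespondence_primitivePart`, Charles's Lemma 7), so are the Lefschetz iterates of the divisor class `κ`,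
and algebraic self-correspondences are closed under composition and `ℂ`-linear combinations.
[cite: Charles2013, Lemma 7 and proof of Prop. 8 (arXiv:1002.5011)] [cite: Andre1996Motifs, §1.1 and §2.1] -/
theorem isAlgebraicCorrespondence_polarizationOperator (hS : IsSmoothProjective l S) {κ : complexBetti S 2}
    (hκ : IsPolarizationClass l S κ) (hvan : ∀ m, 2 * l < m → Subsingleton (complexBetti S m)) {b a' : ℕ}
    (hbl : b ≤ l) (hab : a' + b = 2 * l)
    (hB : ∀ (a₁ b₁ : ℕ) (hab₁ : a₁ + b₁ = 2 * l), b₁ + 2 ≤ b →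
      IsAlgebraicCorrespondence l l S S (lefschetzInvolution hκ.hasHardLefschetz hab₁)) :
    IsAlgebraicCorrespondence l l S S
      (∑ p : {p : ℕ × ℕ // p.1 + 2 * p.2 = b},
        ((-1 : ℂ) ^ (p.1.1 * (p.1.1 - 1) / 2)) •
          (lefschetzPowTo κ (l - p.1.1 - p.1.2) p.1.1 a' (by have := p.2; omega) ∘ₗ
            primitivePart κ l hκ.hasHardLefschetz hvan p)) := by
  refine IsAlgebraicCorrespondence.sum hS hS Finset.univ _ _ (fun p ↦ ?_) ⟨(b, 0), by simp⟩
  exact IsAlgebraicCorrespondence.comp hS hS hS (isAlgebraicCorrespondence_primitivePart hS hκ hvan hbl hB p)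
    (isAlgebraicCorrespondence_lefschetzPowTo hS hκ.mem_algebraicClasses _ (by omega)) (by omega)

end Summit.HodgeConjecture.HodgeConjecture.Theorems.LefschetzStandardB

end
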